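import Mathlib
import Literature.Analysis.FluidPDE.VectorCalculus
import Literature.Analysis.FluidPDE.LeraySchemePressure
import Literature.Analysis.FluidPDE.LerayProfileCalculus

/-!
# `¬ CorrectorSolvable` (stmt-NavierStokesRegularity-1429), line `Sketch`: stub `correctorKill_pressureBound`

Helper file for the crux `Summit.NavierStokesRegularity.NavierStokesRegularity.Theses.AdiabaticEddy.CorrectorSolvable`
of route AdiabaticEddy (lands `--supports stmt-NavierStokesRegularity-1429`).  The line reads the
first-order corrector equation

  (★) `(U·∇)W + (W·∇)U + ∇q = ΔU − aU + b(y·∇)U + (c·∇)U`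

as a Stokes-type system for `(U, q)`; this file is its PRESSURE ROW.  Taking the divergence of (★)
and using `div U = div W = 0` kills `ΔU` (`div Δ = 0` on divergence-free fields), `aU`, `b(y·∇)U`
(`div (y·∇)U = div U + y·∇ div U = 0`) and `(c·∇)U` (`div ∂_c U = ∂_c div U = 0`), and leaves
`Δq = −tr(DW∘DU) − tr(DU∘DW)`; hence `|Δq(y)| ≤ 6 ‖DW(y)‖ ‖DU(y)‖`, and `‖DW‖` is bounded on every
ball.  Tree tools: `divergence_gradient`, `divergence_laplacian_eq_zero`,
`divergence_fderiv_apply_self_eq_zero`, `VectorCalculus.IsDivFree.fderiv_apply`,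
`divergence_convect_eq_sum`.
-/

noncomputable section

-- the summit-side namespace `Summit.NavierStokesRegularity.NavierStokesRegularity.…` repeats a component by design (D-0017)
set_option linter.dupNamespace false

namespace Summit.NavierStokesRegularity.NavierStokesRegularity.Theorems

open Set Metric InnerProductSpace
open scoped RealInnerProductSpace Laplacian
open Literature.Analysis.FluidPDE

/-- `|Σⱼ ⟪eⱼ, A (B eⱼ)⟫| ≤ 3 ‖A‖ ‖B‖` for an orthonormal basis `e` of `ℝ³` (`|tr(A∘B)| ≤ 3‖A‖‖B‖`).
[folklore] -/
theorem correctorKill_abs_sum_inner_comp_le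
    (e : OrthonormalBasis (Fin 3) ℝ (EuclideanSpace ℝ (Fin 3)))
    (A B : EuclideanSpace ℝ (Fin 3) →L[ℝ] EuclideanSpace ℝ (Fin 3)) :
    |∑ j, ⟪e j, A (B (e j))⟫| ≤ 3 * (‖A‖ * ‖B‖) := by
  calc |∑ j, ⟪e j, A (B (e j))⟫| ≤ ∑ j, |⟪e j, A (B (e j))⟫| := Finset.abs_sum_le_sum_abs _ _
    _ ≤ ∑ _j : Fin 3, ‖A‖ * ‖B‖ := Finset.sum_le_sum fun j _ => by
        calc |⟪e j, A (B (e j))⟫| ≤ ‖e j‖ * ‖A (B (e j))‖ := abs_real_inner_le_norm _ _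
          _ ≤ 1 * (‖A‖ * (‖B‖ * 1)) := by
              rw [e.orthonormal.1 j, one_mul, one_mul, mul_one]
              calc ‖A (B (e j))‖ ≤ ‖A‖ * ‖B (e j)‖ := A.le_opNorm _
                _ ≤ ‖A‖ * (‖B‖ * ‖e j‖) :=
                    mul_le_mul_of_nonneg_left (B.le_opNorm _) (norm_nonneg _)
                _ = ‖A‖ * ‖B‖ := by rw [e.orthonormal.1 j, mul_one]
          _ = ‖A‖ * ‖B‖ := by ring
    _ = 3 * (‖A‖ * ‖B‖) := by simp

/-- **The pressure row of the corrector equation (pointwise identity).** For `U ∈ C³`, `W, q ∈ C²`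
with `div U = div W = 0` solving (★), `Δq(y) = −(Σⱼ ⟪eⱼ, DW (DU eⱼ)⟫ + Σⱼ ⟪eⱼ, DU (DW eⱼ)⟫)`, i.e.
`Δq = −tr(DW∘DU) − tr(DU∘DW)`. [folklore] -/
theorem correctorKill_laplacian_pressure_eq
    (U W : EuclideanSpace ℝ (Fin 3) → EuclideanSpace ℝ (Fin 3)) (q : EuclideanSpace ℝ (Fin 3) → ℝ)
    (a b : ℝ) (c : EuclideanSpace ℝ (Fin 3)) (hU : ContDiff ℝ 3 U) (hW : ContDiff ℝ 2 W)
    (hq : ContDiff ℝ 2 q) (hdivU : Literature.Analysis.FluidPDE.VectorCalculus.IsDivFree U)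
    (hdivW : Literature.Analysis.FluidPDE.VectorCalculus.IsDivFree W)
    (hcorr : ∀ y, Literature.Analysis.FluidPDE.convect U W y +
      Literature.Analysis.FluidPDE.convect W U y + gradient q y =
      Laplacian.laplacian U y - a • U y + b • (fderiv ℝ U y) y + (fderiv ℝ U y) c)
    (e : OrthonormalBasis (Fin 3) ℝ (EuclideanSpace ℝ (Fin 3))) (y : EuclideanSpace ℝ (Fin 3)) :
    Laplacian.laplacian q y =
      -((∑ j, ⟪e j, fderiv ℝ W y (fderiv ℝ U y (e j))⟫) +
        ∑ j, ⟪e j, fderiv ℝ U y (fderiv ℝ W y (e j))⟫) := by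
  have hU2 : ContDiff ℝ 2 U := hU.of_le (by norm_num)
  have hU1 : ContDiff ℝ 1 U := hU.of_le (by norm_num)
  have hW1 : ContDiff ℝ 1 W := hW.of_le (by norm_num)
  have hUd : Differentiable ℝ U := hU1.differentiable one_ne_zero
  have hWd : Differentiable ℝ W := hW1.differentiable one_ne_zero
  have hDUd : Differentiable ℝ (fderiv ℝ U) :=
    (hU2.fderiv_right (m := 1) le_rfl).differentiable one_ne_zero
  have hDWd : Differentiable ℝ (fderiv ℝ W) :=
    (hW.fderiv_right (m := 1) le_rfl).differentiable one_ne_zero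
  -- (★) solved for the pressure gradient
  have hgrad : gradient q = fun x => (Δ U) x - a • U x + b • fderiv ℝ U x x + fderiv ℝ U x c -
      convect U W x - convect W U x := by
    funext x
    have hx := hcorr x
    rw [← sub_eq_zero, ← hx]
    abel
  rw [← divergence_gradient hq y, hgrad]
  -- differentiability of the summands
  have hdA : DifferentiableAt ℝ (Δ U) y := differentiable_laplacian hU y
  have hdB : DifferentiableAt ℝ (fun x => a • U x) y := (hUd y).const_smul a
  have hdC' : DifferentiableAt ℝ (fun x => fderiv ℝ U x x) y :=
    (hDUd y).clm_apply differentiableAt_fun_id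
  have hdC : DifferentiableAt ℝ (fun x => b • fderiv ℝ U x x) y := hdC'.const_smul b
  have hdD : DifferentiableAt ℝ (fun x => fderiv ℝ U x c) y :=
    (hDUd y).clm_apply (differentiableAt_const c)
  have hdE : DifferentiableAt ℝ (convect U W) y := (hDWd y).clm_apply (hUd y)
  have hdF : DifferentiableAt ℝ (convect W U) y := (hDUd y).clm_apply (hWd y)
  have hdAB : DifferentiableAt ℝ (fun x => (Δ U) x - a • U x) y := hdA.sub hdB
  have hdABC : DifferentiableAt ℝ (fun x => (Δ U) x - a • U x + b • fderiv ℝ U x x) y :=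
    hdAB.add hdC
  have hdABCD : DifferentiableAt ℝ
      (fun x => (Δ U) x - a • U x + b • fderiv ℝ U x x + fderiv ℝ U x c) y := hdABC.add hdD
  have hdABCDE : DifferentiableAt ℝ
      (fun x => (Δ U) x - a • U x + b • fderiv ℝ U x x + fderiv ℝ U x c - convect U W x) y :=
    hdABCD.sub hdE
  -- `div ∂_c U = ∂_c div U = 0`
  have hDc : VectorCalculus.divergence (fun x => fderiv ℝ U x c) y = 0 :=
    (hdivU.fderiv_apply hU2 c) y
  rw [divergence_sub_apply hdABCDE hdF, divergence_sub_apply hdABCD hdE,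
    divergence_add_apply hdABC hdD, divergence_add_apply hdAB hdC, divergence_sub_apply hdA hdB,
    divergence_const_smul_apply (hUd y), divergence_const_smul_apply hdC',
    divergence_laplacian_eq_zero hU hdivU, hdivU y, divergence_fderiv_apply_self_eq_zero hU2 hdivU,
    hDc, divergence_convect_eq_sum e hW hU1 hdivW, divergence_convect_eq_sum e hU2 hW1 hdivU]
  ring

/-- **Stub D (pressure row: the divergence of (★)).** For `U ∈ C³`, `W, q ∈ C²` with
`div U = div W = 0`, taking the divergence of (★) kills `ΔU` (`div Δ = Δ div`), `aU`, `b(y·∇)U`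
(`div (y·∇)U = div U + y·∇ div U`), `(c·∇)U` and leaves
`Δq = −tr(DW∘DU) − tr(DU∘DW)` (`correctorKill_laplacian_pressure_eq`), whence
`‖Δq(y)‖ ≤ C (‖U(y)‖ + ‖DU(y)‖)` on every ball (`|tr(A∘B)| ≤ 3‖A‖‖B‖` on `ℝ³`, `‖DW‖` bounded on the
closed ball; `C = 6 sup ‖DW‖`). [folklore] -/
theorem correctorKill_pressureBound
    (U W : EuclideanSpace ℝ (Fin 3) → EuclideanSpace ℝ (Fin 3)) (q : EuclideanSpace ℝ (Fin 3) → ℝ)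
    (a b : ℝ) (c : EuclideanSpace ℝ (Fin 3)) (hU : ContDiff ℝ 3 U) (hW : ContDiff ℝ 2 W)
    (hq : ContDiff ℝ 2 q) (hdivU : Literature.Analysis.FluidPDE.VectorCalculus.IsDivFree U)
    (hdivW : Literature.Analysis.FluidPDE.VectorCalculus.IsDivFree W)
    (hcorr : ∀ y, Literature.Analysis.FluidPDE.convect U W y +
      Literature.Analysis.FluidPDE.convect W U y + gradient q y =
      Laplacian.laplacian U y - a • U y + b • (fderiv ℝ U y) y + (fderiv ℝ U y) c)
    (x₀ : EuclideanSpace ℝ (Fin 3)) (R : ℝ) :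
    ∃ C : ℝ, 0 ≤ C ∧ ∀ y ∈ Metric.ball x₀ R,
      ‖Laplacian.laplacian q y‖ ≤ C * (‖U y‖ + ‖fderiv ℝ U y‖) := by
  set e := EuclideanSpace.basisFun (Fin 3) ℝ
  -- `‖DW‖` is bounded on the closed ball
  obtain ⟨M, hM⟩ := (isCompact_closedBall x₀ R).exists_bound_of_continuousOn
    ((hW.continuous_fderiv two_ne_zero).continuousOn)
  refine ⟨6 * max M 0, by positivity, fun y hy => ?_⟩
  have hMy : ‖fderiv ℝ W y‖ ≤ max M 0 := (hM y (ball_subset_closedBall hy)).trans (le_max_left _ _)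
  have h1 := correctorKill_abs_sum_inner_comp_le e (fderiv ℝ W y) (fderiv ℝ U y)
  have h2 := correctorKill_abs_sum_inner_comp_le e (fderiv ℝ U y) (fderiv ℝ W y)
  rw [correctorKill_laplacian_pressure_eq U W q a b c hU hW hq hdivU hdivW hcorr e y,
    Real.norm_eq_abs, abs_neg]
  have hU0 : 0 ≤ ‖U y‖ := norm_nonneg _
  have hDU0 : 0 ≤ ‖fderiv ℝ U y‖ := norm_nonneg _
  have hM0 : 0 ≤ max M 0 := le_max_right _ _
  calc |(∑ j, ⟪e j, fderiv ℝ W y (fderiv ℝ U y (e j))⟫) +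
          ∑ j, ⟪e j, fderiv ℝ U y (fderiv ℝ W y (e j))⟫|
        ≤ |∑ j, ⟪e j, fderiv ℝ W y (fderiv ℝ U y (e j))⟫| +
          |∑ j, ⟪e j, fderiv ℝ U y (fderiv ℝ W y (e j))⟫| := abs_add_le _ _
    _ ≤ 3 * (‖fderiv ℝ W y‖ * ‖fderiv ℝ U y‖) + 3 * (‖fderiv ℝ U y‖ * ‖fderiv ℝ W y‖) :=
        add_le_add h1 h2
    _ = 6 * ‖fderiv ℝ W y‖ * ‖fderiv ℝ U y‖ := by ring
    _ ≤ 6 * max M 0 * ‖fderiv ℝ U y‖ := by gcongr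
    _ ≤ 6 * max M 0 * (‖U y‖ + ‖fderiv ℝ U y‖) := by
        gcongr
        linarith

end Summit.NavierStokesRegularity.NavierStokesRegularity.Theorems

end
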